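import Literature.Analysis.FluidPDE.CheskidovShvydkoyRegular
import Literature.Analysis.FluidPDE.NSSerrinUniquenessForced
import HarnessLib

/-!
# Restarting a FORCED Leray–Hopf weak solution at almost every time

Analysis/FluidPDE support file — the forced twin of `LerayHopfRestart.lean` (which treats the
unforced system, `f = 0`). For a Leray–Hopf weak solution `IsLerayHopfOn T ν f u₀ u` of the
Navier–Stokes system on `E × [0, T)` driven by a force `f ∈ L²((0,T) × E)` that is jointly
a.e.-strongly measurable (the guarded force class of the tree's forced Serrin–Masuda theorem
`serrinMasuda_weak_strong_uniqueness_forced`, Sohr 2001, Ch. V (1.4.4)/(1.5.3) with `T < ∞`), the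
time translate `u(· + s)` is a Leray–Hopf weak solution on `[0, T - s)` with force `f(· + s)` from
the datum `u(s)` for almost every `s ∈ (0, T)` — every `s` from which the energy inequality (with
the work term `∫ₛᵗ∫⟪f, u⟫`) holds (`IsLerayHopfOn.ae_isLerayHopfOn_restart_forced`).

This is the folklore restarting remark of Robinson–Rodrigo–Sadowski 2016 (Def. 4.9: the strong
energy inequality "for `s = 0` and almost all times `s`"; Cor. 4.8: strong right-continuity in
`L²` at such times; p. 131, proof of Thm. 8.17 from Lemma 8.16) and of Sohr 2001, Ch. V, Thm. 1.8.1
(proof, the reduction "Since `T` can be replaced by `T'` …" and the iteration after (1.8.20), which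
restarts the forced weak solution at intermediate times), written for the tree's notion
`IsWeakNSSolutionOn` whose test fields live on `(-∞, T) × E` with the datum term at `t = 0`.

## Proof (the unforced file with the force threaded through)

* *Force bookkeeping* (`ForceShift`): the translate `f(· + s)` of an `L²((0,T) × E)` force is an
  `L²((0,T-s) × E)` force with the same bound (time shift = measure-preserving embedding of
  `ℝ × E`), and such a force is integrable on every finite cylinder `(0,T) × K`.
* *Strong right-continuity at good times* (`IsLerayHopfOn.tendsto_eLpNorm_sub_nhdsGT_of_le_add`,
  the `E`-side twin of the accepted torus lemma of the same name; `…_forced`): at a time `s` from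
  which the forced energy inequality holds, `E(u(t)) ≤ E(u(s)) + ∫ₛᵗ∫⟪f,u⟫` and the work tends to
  `0` as `t → s⁺` (the work density is integrable, `IsLerayHopfOn.integrableOn_forceWork`), so
  `‖u(t) - u(s)‖₂ → 0` by weak continuity tested against `u(s)` (RRS Cor. 4.8).
* *The weak identity of the translate on the open slab*
  (`IsWeakNSSolutionOn.setIntegral_translate_test_eq_zero_forced`): test with `ψ(t - s, x)`,
  discard the initial layer `(0, s]` (where the shifted test field and hence also the force pairing
  vanish), change variables; *the datum term* by the accepted cut-off argument
  `weakIdentity_datum_of_tested` (which already carries a force).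
* The remaining Leray–Hopf clauses translate as in the unforced file, the work terms by the change
  of variables `∫₀ᵗ W(τ + s) dτ = ∫ₛ^{t+s} W` (`intervalIntegral.integral_comp_add_right`).

## References

* J. C. Robinson, J. L. Rodrigo, W. Sadowski, *The three-dimensional Navier–Stokes equations.
  Classical theory* (CUP 2016), Def. 4.9, Cor. 4.8 (with Lemma A.20), p. 131. [RobinsonRodrigoSadowski2016]
* H. Sohr, *The Navier–Stokes Equations. An Elementary Functional Analytic Approach*, Birkhäuser
  2001, Ch. V, Def. 1.1.1, (1.4.4), Thm. 1.8.1 (proof). [Sohr2001]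
* J. Leray, Acta Math. 63 (1934), (17), §31 (5.1)–(5.2). [Leray1934]
-/

noncomputable section

open MeasureTheory TopologicalSpace Set Function Filter Topology InnerProductSpace Metric
open scoped RealInnerProductSpace ENNReal NNReal Laplacian

namespace Literature.Analysis.FluidPDE

/-! ### Time translates of an `L²((0,T) × E)` force -/

section ForceShift

variable {E : Type*} [NormedAddCommGroup E] [InnerProductSpace ℝ E] [FiniteDimensional ℝ E]
  [MeasurableSpace E] [BorelSpace E]
variable {T : ℝ} {f : ℝ → E → E}

/-- The translate `f(· + s)`, `s ≥ 0`, of a field jointly a.e.-strongly measurable on the slab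
`(0,T) × E` is jointly a.e.-strongly measurable on `(0, T - s) × E` (product-measure form of the
accepted `aestronglyMeasurable_uncurry_translate`; Serrin 1963, §3: the space–time classes are
translation invariant). [cite: Serrin1963, §3 (translation invariance of the classes L^{p,q})] -/
theorem aestronglyMeasurable_uncurry_translate_prod {s : ℝ} (hs : 0 ≤ s)
    (hfm : AEStronglyMeasurable (uncurry f) ((volume.restrict (Ioo 0 T)).prod (volume : Measure E))) :
    AEStronglyMeasurable (uncurry fun t => f (t + s))
      ((volume.restrict (Ioo 0 (T - s))).prod (volume : Measure E)) := by
  rw [restrict_prod_volume_eq] at hfm ⊢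
  exact aestronglyMeasurable_uncurry_translate hs hfm

/-- The `L^p((0,T-s) × E)` norm of the translate `f(· + s)`, `s ≥ 0`, is at most the
`L^p((0,T) × E)` norm of `f` (the time shift is a measure-preserving embedding of `ℝ × E` carrying
the cylinder `(0, T - s) × E` onto `(s, T) × E ⊆ (0, T) × E`; Serrin 1963, §3: the classes
`L^{p,q}` are translation invariant). [cite: Serrin1963, §3 (translation invariance of the classes L^{p,q})] -/
theorem eLpNorm_uncurry_translate_le {s : ℝ} (hs : 0 ≤ s) (p : ℝ≥0∞) :
    eLpNorm (uncurry fun t => f (t + s)) p ((volume.restrict (Ioo 0 (T - s))).prod (volume : Measure E)) ≤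
      eLpNorm (uncurry f) p ((volume.restrict (Ioo 0 T)).prod (volume : Measure E)) := by
  rw [restrict_prod_volume_eq, restrict_prod_volume_eq]
  have hmp := measurePreserving_timeShift_restrict (E := E) s 0 (T - s) univ
  have hme := measurableEmbedding_timeShift (E := E) s
  have h1 := hme.eLpNorm_map_measure (μ := (volume : Measure (ℝ × E)).restrict (Ioo 0 (T - s) ×ˢ univ))
    (g := uncurry f) (p := p)
  rw [hmp.map_eq] at h1
  have h2 : (uncurry f ∘ fun z : ℝ × E => (z.1 + s, z.2)) = uncurry fun t => f (t + s) := by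
    funext z; rfl
  rw [h2] at h1
  rw [← h1]
  have hsub : Ioo (0 + s) (T - s + s) ×ˢ (univ : Set E) ⊆ Ioo 0 T ×ˢ univ :=
    prod_mono (fun t ht => ⟨by linarith [ht.1], by linarith [ht.2]⟩) Subset.rfl
  exact eLpNorm_mono_measure _ (Measure.restrict_mono hsub le_rfl)

/-- A field in `L²((0,T) × E)` (jointly a.e.-strongly measurable) is integrable on every finite
cylinder `(0,T) × K`, `K` compact (Cauchy–Schwarz on a set of finite measure; the accepted
`integrableOn_cylinder_of_lintegral_sq_slab`; the standing local integrability of the force class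
`L²(0,T;L²)` in Sohr 2001, Ch. V §1.4). [cite: Sohr2001, Ch. V §1.4, proof of Thm. 1.4.1 (bookkeeping step)] -/
theorem integrableOn_cylinder_of_eLpNorm_prod
    (hfm : AEStronglyMeasurable (uncurry f) ((volume.restrict (Ioo 0 T)).prod (volume : Measure E)))
    (hf2 : eLpNorm (uncurry f) 2 ((volume.restrict (Ioo 0 T)).prod (volume : Measure E)) < ⊤)
    {K : Set E} (hK : IsCompact K) : IntegrableOn (uncurry f) (Ioo 0 T ×ˢ K) volume := by
  rw [restrict_prod_volume_eq] at hfm hf2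
  have hslab : ∫⁻ z in Ioo 0 T ×ˢ (univ : Set E), ‖uncurry f z‖ₑ ^ 2 < ⊤ := by
    have h := ENNReal.rpow_lt_top_of_nonneg zero_le_two hf2.ne
    rw [eLpNorm_eq_eLpNorm' two_ne_zero ENNReal.ofNat_ne_top, ENNReal.toReal_ofNat,
      ← lintegral_rpow_enorm_eq_rpow_eLpNorm' zero_lt_two] at h
    refine lt_of_le_of_lt (le_of_eq (lintegral_congr fun z => ?_)) h
    exact (ENNReal.rpow_two _).symm
  have hL2 : ∀ K' : Set E, IsCompact K' → ∫⁻ z in Ioo 0 T ×ˢ K', ‖uncurry f z‖ₑ ^ 2 < ⊤ :=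
    fun K' _ => (lintegral_mono_set (prod_mono Subset.rfl (subset_univ K'))).trans_lt hslab
  exact (integrableOn_cylinder_of_lintegral_sq_slab hfm hL2 hK).1

end ForceShift

/-! ### Strong right-continuity at times from which the forced energy inequality holds -/

section StrongContinuity

variable {E : Type*} [NormedAddCommGroup E] [InnerProductSpace ℝ E] [FiniteDimensional ℝ E]
  [MeasurableSpace E] [BorelSpace E]
variable {T ν : ℝ} {f u : ℝ → E → E} {u₀ : E → E}

/-- **Strong right-continuity in `L²` from an almost non-increasing energy** (Robinson–Rodrigo–
Sadowski 2016, Cor. 4.8 with Lemma A.20, forced form; the `E`-side twin of the accepted torus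
lemma `Torus.IsLerayHopfOn.tendsto_eLpNorm_sub_nhdsGT_of_le_add`). Let `u` be a Leray–Hopf weak
solution on `E × [0, T)` and `s ∈ (0, T)` a time such that `E(u(t)) ≤ E(u(s)) + R(t)` for
`t ∈ [s, T]` with `R(t) → 0` as `t → s⁺`. Then `‖u(t) - u(s)‖_{L²} → 0` as `t → s⁺`:
`2E(u(t) - u(s)) = 2E(u(t)) - 2∫⟪u(t), u(s)⟫ + 2E(u(s)) ≤ 4E(u(s)) + 2R(t) - 2∫⟪u(t), u(s)⟫ → 0`
by weak continuity tested against `u(s) ∈ L²`. [cite: RobinsonRodrigoSadowski2016, Cor. 4.8 (with Lemma A.20)] -/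
theorem IsLerayHopfOn.tendsto_eLpNorm_sub_nhdsGT_of_le_add (h : IsLerayHopfOn T ν f u₀ u) {s : ℝ}
    (hs : s ∈ Ioo 0 T) {R : ℝ → ℝ} (hR : Tendsto R (𝓝[>] s) (𝓝 0))
    (hE : ∀ t ∈ Icc s T, VectorCalculus.kineticEnergy (u t) ≤ VectorCalculus.kineticEnergy (u s) + R t) :
    Tendsto (fun t => eLpNorm (u t - u s) 2 volume) (𝓝[>] s) (𝓝 0) := by
  have hvs : MemLp (u s) 2 volume := h.memLp s ⟨hs.1.le, hs.2.le⟩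
  set P : ℝ → ℝ := fun t => ∫ x, ⟪u t x, u s x⟫ with hP
  -- weak continuity tested against `u s`
  have hPc : Tendsto P (𝓝[>] s) (𝓝 (P s)) :=
    (((h.weak_continuous (u s) hvs).1.continuousAt (Ioc_mem_nhds hs.1 hs.2)).tendsto).mono_left
      nhdsWithin_le_nhds
  have hPs : P s = 2 * VectorCalculus.kineticEnergy (u s) := by
    simp only [hP, VectorCalculus.kineticEnergy, real_inner_self_eq_norm_sq]
    ring
  -- the energy of the difference tends to zero
  have hev : ∀ᶠ t in 𝓝[>] s, t ∈ Ioo s T := Ioo_mem_nhdsGT hs.2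
  have hKE : Tendsto (fun t => VectorCalculus.kineticEnergy (u t - u s)) (𝓝[>] s) (𝓝 0) := by
    have hup : Tendsto (fun t => 2 * VectorCalculus.kineticEnergy (u s) + R t - P t) (𝓝[>] s) (𝓝 0) := by
      have := ((tendsto_const_nhds (x := 2 * VectorCalculus.kineticEnergy (u s))).add hR).sub hPc
      rwa [hPs, add_zero, sub_self] at this
    refine tendsto_of_tendsto_of_tendsto_of_le_of_le' tendsto_const_nhds hup ?_ ?_
    · exact Eventually.of_forall fun t => kineticEnergy_nonneg _
    · filter_upwards [hev] with t ht
      have hut : MemLp (u t) 2 volume := h.memLp t ⟨hs.1.le.trans ht.1.le, ht.2.le⟩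
      rw [kineticEnergy_sub hut hvs]
      have := hE t ⟨ht.1.le, ht.2.le⟩
      show VectorCalculus.kineticEnergy (u t) - P t + VectorCalculus.kineticEnergy (u s) ≤
        2 * VectorCalculus.kineticEnergy (u s) + R t - P t
      linarith
  -- convert to the `L²` norm
  have hE2 : Tendsto (fun t => eEnergy (u t - u s)) (𝓝[>] s) (𝓝 0) := by
    have h1 : Tendsto (fun t => ENNReal.ofReal (2 * VectorCalculus.kineticEnergy (u t - u s))) (𝓝[>] s)
        (𝓝 0) := by
      have := ENNReal.tendsto_ofReal (hKE.const_mul 2)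
      rwa [mul_zero, ENNReal.ofReal_zero] at this
    refine h1.congr' ?_
    filter_upwards [hev] with t ht
    have hut : MemLp (u t) 2 volume := h.memLp t ⟨hs.1.le.trans ht.1.le, ht.2.le⟩
    exact (eEnergy_eq_ofReal _ (hut.sub hvs)).symm
  have h3 : Tendsto (fun t => eEnergy (u t - u s) ^ (2⁻¹ : ℝ)) (𝓝[>] s) (𝓝 0) := by
    have := (ENNReal.continuous_rpow_const (y := (2⁻¹ : ℝ))).tendsto 0 |>.comp hE2
    rwa [ENNReal.zero_rpow_of_pos (by norm_num)] at this
  refine h3.congr fun t => ?_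
  rw [eEnergy_eq_eLpNorm_sq, ← ENNReal.rpow_natCast, ← ENNReal.rpow_mul]
  norm_num

/-- **Strong right-continuity at a time from which the FORCED energy inequality holds**
(Robinson–Rodrigo–Sadowski 2016, Cor. 4.8; Sohr 2001, Ch. V (1.4.4)). Let `u` be a Leray–Hopf weak
solution on `E × [0, T)` with a force `f ∈ L²((0,T) × E)` (jointly a.e.-strongly measurable), and
let `s ∈ (0, T)` be a time from which the energy inequality
`E(u(t)) + ν∫ₛᵗ‖G‖² ≤ E(u(s)) + ∫ₛᵗ∫⟪f, u⟫` holds for `t ∈ [s, T]` (`ν ≥ 0`). Then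
`‖u(t) - u(s)‖_{L²} → 0` as `t → s⁺`: the work density `τ ↦ ∫⟪f(τ), u(τ)⟫` is integrable on
`(0,T)` (`IsLerayHopfOn.integrableOn_forceWork`), so its primitive from `s` tends to `0` at `s⁺`,
and `tendsto_eLpNorm_sub_nhdsGT_of_le_add` applies. [cite: RobinsonRodrigoSadowski2016, Cor. 4.8 (with Lemma A.20)] -/
theorem IsLerayHopfOn.tendsto_eLpNorm_sub_nhdsGT_forced (h : IsLerayHopfOn T ν f u₀ u) (hν : 0 ≤ ν)
    (hfm : AEStronglyMeasurable (uncurry f) ((volume.restrict (Ioo 0 T)).prod (volume : Measure E)))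
    (hf2 : eLpNorm (uncurry f) 2 ((volume.restrict (Ioo 0 T)).prod (volume : Measure E)) < ⊤)
    {s : ℝ} (hs : s ∈ Ioo 0 T) {G : ℝ → E → E →L[ℝ] E}
    (hEs : ∀ t ∈ Icc s T, VectorCalculus.kineticEnergy (u t) +
      ν * (∫⁻ τ in Ioo s t, ∫⁻ x, ENNReal.ofReal (frobeniusNormSq (G τ x))).toReal ≤
        VectorCalculus.kineticEnergy (u s) + ∫ τ in s..t, ∫ x, ⟪f τ x, u τ x⟫) :
    Tendsto (fun t => eLpNorm (u t - u s) 2 volume) (𝓝[>] s) (𝓝 0) := by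
  set W : ℝ → ℝ := fun τ => ∫ x, ⟪f τ x, u τ x⟫ with hW
  have hWi : IntegrableOn W (Ioo 0 T) := h.integrableOn_forceWork hfm hf2
  -- the primitive of the work from `s` tends to zero at `s⁺`
  have hR : Tendsto (fun t => ∫ τ in s..t, W τ) (𝓝[>] s) (𝓝 0) := by
    have hWi' : IntervalIntegrable W volume s T :=
      (intervalIntegrable_iff_integrableOn_Ioo_of_le hs.2.le).2
        (hWi.mono_set (Ioo_subset_Ioo_left hs.1.le))
    have hc := intervalIntegral.continuousOn_primitive_interval' hWi' left_mem_uIcc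
    have hcs : ContinuousWithinAt (fun b => ∫ x in s..b, W x) (uIcc s T) s := hc s left_mem_uIcc
    rw [ContinuousWithinAt, intervalIntegral.integral_same, uIcc_of_le hs.2.le] at hcs
    exact hcs.mono_left (nhdsWithin_le_iff.2 (mem_of_superset (Ioo_mem_nhdsGT hs.2) Ioo_subset_Icc_self))
  refine h.tendsto_eLpNorm_sub_nhdsGT_of_le_add hs hR fun t ht => ?_
  have h1 := hEs t ht
  have h2 : 0 ≤ ν * (∫⁻ τ in Ioo s t, ∫⁻ x, ENNReal.ofReal (frobeniusNormSq (G τ x))).toReal :=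
    mul_nonneg hν ENNReal.toReal_nonneg
  linarith

end StrongContinuity

/-! ### The weak formulation of the translate on the open slab (forced) -/

section TranslateTest

variable {E : Type*} [NormedAddCommGroup E] [InnerProductSpace ℝ E] [FiniteDimensional ℝ E]
  [MeasurableSpace E] [BorelSpace E]
variable {T ν : ℝ} {f u : ℝ → E → E} {u₀ : E → E}

/-- **The translate satisfies the forced weak identity against tests on the open slab.** Let `u`
be a weak solution of the forced system on `E × [0, T)` and `0 < s`. For every test field `ψ` on
the open slab `(0, T - s) × E` with divergence-free slices,
`∫₀^{T-s} ∫ (⟪u(t+s), ∂ₜψ⟫ + ⟪u(t+s), (u(t+s)·∇)ψ⟫ + ν⟪u(t+s), Δψ⟫ + ⟪f(t+s), ψ⟫) = 0`: test the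
weak formulation of `u` with the shifted field `ψ(t - s, x)` (a test field on `(s, T) × E`,
vanishing at `t = 0` together with the datum term), discard the initial layer `(0, s]` on which
the integrand — including the force pairing — vanishes, and change variables `t ↦ t + s`
(Leray 1934, (17); the accepted unforced `IsWeakNSSolutionOn.setIntegral_translate_test_eq_zero`
with the force threaded through; Robinson–Rodrigo–Sadowski 2016, Def. 3.3 (ii): the weak formulation
from intermediate initial times). [cite: RobinsonRodrigoSadowski2016, Def. 3.3 (ii)] -/
theorem IsWeakNSSolutionOn.setIntegral_translate_test_eq_zero_forced
    (hw : IsWeakNSSolutionOn T ν f u₀ u) {s : ℝ} (hs : 0 < s) {ψ : ℝ → E → E}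
    (hψ : IsSpaceTimeTestOn (slab E (Ioo 0 (T - s)) isOpen_Ioo) ψ)
    (hdiv : ∀ t, VectorCalculus.IsDivFree (ψ t)) :
    ∫ t in Ioo 0 (T - s), ∫ x, (⟪u (t + s) x, timeDeriv ψ t x⟫ +
        ⟪u (t + s) x, convect (u (t + s)) (ψ t) x⟫ + ν * ⟪u (t + s) x, Δ (ψ t) x⟫ +
        ⟪f (t + s) x, ψ t x⟫) = 0 := by
  set ψs : ℝ → E → E := fun t x => ψ (t - s) x with hψs_def
  have hψs : IsSpaceTimeTestOn (slab E (Ioo s T) isOpen_Ioo) ψs := hψ.comp_sub_time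
  have hψsT : IsSpaceTimeTestOn (slab E (Iio T) isOpen_Iio) ψs :=
    hψs.mono (slab_mono Ioo_subset_Iio_self)
  have hdivs : ∀ t, VectorCalculus.IsDivFree (ψs t) := fun t => hdiv (t - s)
  have key := hw.2.2.2 ψs hψsT hdivs
  -- the datum term vanishes: `ψˢ(0, ·) = ψ(-s, ·) = 0`
  have hz0 : ∀ x : E, ((0 : ℝ), x) ∉ ((slab E (Ioo s T) isOpen_Ioo : Opens (ℝ × E)) : Set (ℝ × E)) :=
    fun x hx => by
      have := (mem_slab.1 (SetLike.mem_coe.1 hx)).1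
      linarith
  have h0 : ∀ x, ψs 0 x = 0 := fun x => hψs.apply_eq_zero (hz0 x)
  simp only [h0, inner_zero_right, integral_zero, add_zero] at key
  -- the integrand vanishes on the initial layer `(0, s]`
  set F : ℝ → ℝ := fun t => ∫ x, (⟪u t x, timeDeriv ψs t x⟫ + ⟪u t x, convect (u t) (ψs t) x⟫ +
    ν * ⟪u t x, Δ (ψs t) x⟫ + ⟪f t x, ψs t x⟫) with hF
  have key1 : ∫ t in Ioo 0 T, F t = 0 := key
  rcases le_or_gt T s with hTs | hsT
  · -- void case: `(0, T - s)` is empty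
    have he : Ioo (0 : ℝ) (T - s) = ∅ := Ioo_eq_empty_of_le (by linarith)
    rw [he, Measure.restrict_empty, integral_zero_measure]
  have hsub : Ioo s T ⊆ Ioo 0 T := Ioo_subset_Ioo_left hs.le
  rw [setIntegral_eq_of_subset_of_forall_sdiff_eq_zero measurableSet_Ioo hsub] at key1
  swap
  · intro t ht
    have hts : t ≤ s := by
      by_contra h
      exact ht.2 ⟨not_le.1 h, ht.1.2⟩
    have hz : ∀ x : E, (t, x) ∉ ((slab E (Ioo s T) isOpen_Ioo : Opens (ℝ × E)) : Set (ℝ × E)) :=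
      fun x hx => by
        have := (mem_slab.1 (SetLike.mem_coe.1 hx)).1
        linarith
    have h1 : ∀ x, deriv (fun τ => ψs τ x) t = 0 := fun x => hψs.deriv_eq_zero (hz x)
    have h2 : ∀ x, fderiv ℝ (ψs t) x = 0 := fun x => hψs.fderiv_slice_eq_zero (hz x)
    have h3 : ∀ x, Δ (ψs t) x = 0 := fun x => hψs.laplacian_slice_eq_zero (hz x)
    have h4 : ∀ x, ψs t x = 0 := fun x => hψs.apply_eq_zero (hz x)
    simp [hF, h1, convect, h2, h3, h4]
  -- change variables `t ↦ t + s`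
  have hcv := setIntegral_Ioo_comp_add_right F 0 (T - s) s
  rw [zero_add, sub_add_cancel] at hcv
  have hpt : ∀ t, F (t + s) = ∫ x, (⟪u (t + s) x, timeDeriv ψ t x⟫ +
      ⟪u (t + s) x, convect (u (t + s)) (ψ t) x⟫ + ν * ⟪u (t + s) x, Δ (ψ t) x⟫ +
      ⟪f (t + s) x, ψ t x⟫) := by
    intro t
    have hslice : ψs (t + s) = ψ t := by
      funext y
      simp [hψs_def]
    have hder : ∀ y, timeDeriv ψs (t + s) y = timeDeriv ψ t y := fun y =>
      timeDeriv_comp_sub_time ψ s t y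
    simp only [hF, hder]
    rw [hslice]
  refine (setIntegral_congr_fun measurableSet_Ioo fun t _ => (hpt t).symm).trans ?_
  rw [hcv, key1]

end TranslateTest

/-! ### Restarting a forced Leray–Hopf solution -/

section Restart

variable {E : Type*} [NormedAddCommGroup E] [InnerProductSpace ℝ E] [FiniteDimensional ℝ E]
  [MeasurableSpace E] [BorelSpace E]
variable {T ν : ℝ} {f u : ℝ → E → E} {u₀ : E → E}

/-- The shift `t ↦ t + s` maps `𝓝[>] 0` into `𝓝[>] s` (`E`-side copy of the torus helper
`Torus.tendsto_add_right_nhdsGT_zero`). [folklore] -/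
private theorem tendsto_add_right_nhdsGT_zero_real (s : ℝ) :
    Tendsto (fun t : ℝ => t + s) (𝓝[>] (0 : ℝ)) (𝓝[>] s) := by
  have h2 : Tendsto (fun t : ℝ => t + s) (𝓝 0) (𝓝 (0 + s)) :=
    (continuous_id.add continuous_const).tendsto 0
  rw [zero_add] at h2
  refine tendsto_nhdsWithin_iff.2 ⟨h2.mono_left nhdsWithin_le_nhds, ?_⟩
  filter_upwards [self_mem_nhdsWithin] with t ht
  exact show s < t + s by linarith [mem_Ioi.1 ht]

/-- **The translate is a forced weak solution from its initial slice.** Let `u` be a Leray–Hopf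
weak solution of the forced system on `E × [0, T)` with `f ∈ L²((0,T) × E)` jointly
a.e.-strongly measurable, and let `s ∈ (0, T)` be a time at which `u` is strongly right-continuous
in `L²` (`‖u(t) - u(s)‖₂ → 0` as `t → s⁺`, e.g. a time from which the energy inequality holds,
`IsLerayHopfOn.tendsto_eLpNorm_sub_nhdsGT_forced`). Then `u(· + s)` is a weak solution on
`E × [0, T - s)` with force `f(· + s)` and datum `u(s)` (Leray's form (17)): measurability, local
square integrability and the a.e. divergence constraint translate; the weak identity with datum is
the accepted cut-off argument `weakIdentity_datum_of_tested` applied to the translate, whose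
identity against tests on the open slab is `setIntegral_translate_test_eq_zero_forced`, whose force
is integrable on finite cylinders (`integrableOn_cylinder_of_eLpNorm_prod`), and whose datum
`u(s)` is attained in `L²` (Robinson–Rodrigo–Sadowski 2016, Def. 3.3 (ii) with Cor. 4.8; Sohr 2001,
Ch. V, Def. 1.1.1). [cite: RobinsonRodrigoSadowski2016, Def. 3.3 (ii) with Cor. 4.8] -/
theorem IsLerayHopfOn.isWeakNSSolutionOn_translate_forced (hLH : IsLerayHopfOn T ν f u₀ u)
    (hfm : AEStronglyMeasurable (uncurry f) ((volume.restrict (Ioo 0 T)).prod (volume : Measure E)))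
    (hf2 : eLpNorm (uncurry f) 2 ((volume.restrict (Ioo 0 T)).prod (volume : Measure E)) < ⊤)
    {s : ℝ} (hs : s ∈ Ioo 0 T)
    (h0 : Tendsto (fun t => eLpNorm (u t - u s) 2 volume) (𝓝[>] s) (𝓝 0)) :
    IsWeakNSSolutionOn (T - s) ν (fun t => f (t + s)) (u s) (fun t => u (t + s)) := by
  obtain ⟨hmeas, hL2, hdiv, -⟩ := hLH.weak
  have hT' : 0 < T - s := by linarith [hs.2]
  have hsub : Ioo (0 + s) (T - s + s) ⊆ Ioo 0 T := fun t ht =>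
    ⟨by linarith [ht.1, hs.1], by linarith [ht.2]⟩
  have hmeas' : AEStronglyMeasurable (uncurry fun t => u (t + s))
      ((volume : Measure (ℝ × E)).restrict (Ioo 0 (T - s) ×ˢ univ)) :=
    aestronglyMeasurable_uncurry_translate hs.1.le hmeas
  have hL2' : ∀ K : Set E, IsCompact K →
      ∫⁻ z in Ioo 0 (T - s) ×ˢ K, ‖uncurry (fun t => u (t + s)) z‖ₑ ^ 2 < ∞ := fun K hK =>
    lintegral_cylinder_translate_lt_top hs.1.le hL2 hK
  have hdiv' : ∀ᵐ t ∂((volume : Measure ℝ).restrict (Ioo 0 (T - s))),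
      IsWeaklyDivFree (u (t + s)) :=
    ae_restrict_Ioo_comp_add_right s (ae_mono (Measure.restrict_mono hsub le_rfl) hdiv)
  refine ⟨hmeas', hL2', hdiv', fun ψ hψ hψdiv => ?_⟩
  -- the ingredients of the cut-off argument for the translate
  have hUK : ∀ K : Set E, IsCompact K →
      IntegrableOn (uncurry fun t => u (t + s)) (Ioo 0 (T - s) ×ˢ K) volume ∧
        IntegrableOn (fun z => ‖uncurry (fun t => u (t + s)) z‖ ^ 2) (Ioo 0 (T - s) ×ˢ K)
          volume := fun K hK =>
    integrableOn_cylinder_of_lintegral_sq_slab hmeas' hL2' hK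
  have hmom : ∀ φ : ℝ → E → E, IsSpaceTimeTestOn (slab E (Ioo 0 (T - s)) isOpen_Ioo) φ →
      (∀ t, VectorCalculus.IsDivFree (φ t)) →
      ∫ t in Ioo 0 (T - s), ∫ x, (⟪u (t + s) x, timeDeriv φ t x⟫ +
        ⟪u (t + s) x, convect (u (t + s)) (φ t) x⟫ + ν * ⟪u (t + s) x, Δ (φ t) x⟫ +
        ⟪f (t + s) x, φ t x⟫) = 0 := fun φ hφ hφdiv =>
    hLH.weak.setIntegral_translate_test_eq_zero_forced hs.1 hφ hφdiv
  have hf : ∀ K : Set E, IsCompact K →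
      IntegrableOn (uncurry fun t => f (t + s)) (Ioo 0 (T - s) ×ˢ K) volume := fun K hK =>
    integrableOn_cylinder_of_eLpNorm_prod (aestronglyMeasurable_uncurry_translate_prod hs.1.le hfm)
      ((eLpNorm_uncurry_translate_le hs.1.le 2).trans_lt hf2) hK
  have hgood : ∀ᵐ t ∂((volume : Measure ℝ).restrict (Ioo 0 (T - s))),
      AEStronglyMeasurable (u (t + s)) (volume : Measure E) ∧
        ∀ n : ℕ, ∫⁻ x in closedBall (0 : E) n, ‖u (t + s) x‖ₑ ^ 2 < ∞ := by
    filter_upwards [ae_restrict_mem measurableSet_Ioo] with t ht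
    have hmem : MemLp (u (t + s)) 2 volume :=
      hLH.memLp (t + s) ⟨by linarith [ht.1, hs.1], by linarith [ht.2]⟩
    refine ⟨hmem.1, fun n => lt_of_le_of_lt (lintegral_mono_set (subset_univ _)) ?_⟩
    have h1 : eEnergy (u (t + s)) < ∞ := by
      rw [eEnergy_eq_eLpNorm_sq]
      exact ENNReal.pow_lt_top hmem.2
    simpa only [eEnergy, Measure.restrict_univ] using h1
  have hm₀ : AEStronglyMeasurable (u s) (volume : Measure E) :=
    (hLH.memLp s ⟨hs.1.le, hs.2.le⟩).1
  have h₀ : ∀ K : Set E, IsCompact K →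
      Tendsto (fun t => ∫⁻ x in K, ‖u (t + s) x - u s x‖ₑ ^ 2) (𝓝[>] 0) (𝓝 0) := by
    intro K _
    have h3 : Tendsto (fun t => eLpNorm (u (t + s) - u s) 2 volume ^ 2) (𝓝[>] 0) (𝓝 0) := by
      have := ENNReal.Tendsto.pow (n := 2) (h0.comp (tendsto_add_right_nhdsGT_zero_real s))
      simpa using this
    refine tendsto_of_tendsto_of_tendsto_of_le_of_le tendsto_const_nhds h3
      (fun _ => zero_le) fun t => ?_
    have h4 : ∫⁻ x in K, ‖u (t + s) x - u s x‖ₑ ^ 2 ≤ ∫⁻ x, ‖u (t + s) x - u s x‖ₑ ^ 2 :=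
      lintegral_mono_set (subset_univ K) |>.trans_eq (by rw [Measure.restrict_univ])
    refine h4.trans_eq ?_
    rw [← eEnergy_eq_eLpNorm_sq]
    rfl
  exact weakIdentity_datum_of_tested hT' hUK hmom hf hgood hm₀ h₀ hψ hψdiv

/-- **Restarting a forced Leray–Hopf solution at almost every time.** Let `ν ≥ 0` and let `u` be
a Leray–Hopf weak solution of the Navier–Stokes system on `E × [0, T)` driven by a force
`f ∈ L²((0,T) × E)` that is jointly a.e.-strongly measurable (accepted strict-sense
`IsLerayHopfOn`, energy inequalities WITH the work term `∫∫⟪f, u⟫`, from `0` and from a.e. time).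
Then for a.e. `s ∈ (0, T)` — every `s` from which the energy inequality holds — the translate
`u(· + s)` is a Leray–Hopf weak solution on `E × [0, T - s)` with force `f(· + s)` from the datum
`u(s)`: the weak formulation is `isWeakNSSolutionOn_translate_forced` (strong right-continuity at
`s` from the energy inequality, `tendsto_eLpNorm_sub_nhdsGT_forced`); the `L^∞_t L²_x` bound, the
weak gradient `G(· + s)` and its `L²_{t,x}` bound are those of `u`, translated; the energy
inequalities from `0` (= from `s` for `u`) and from a.e. `s'` are those of `u` with the work terms
transported by `∫₀ᵗ W(τ + s) dτ = ∫ₛ^{t+s} W`; weak `L²` continuity and the weak limit at `0⁺` come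
from weak continuity of `u` at the interior time `s`. This is the restarting remark of
Robinson–Rodrigo–Sadowski 2016 (Def. 4.9 and p. 131) and the reduction step of Sohr 2001, Ch. V,
Thm. 1.8.1 (proof), for forced weak solutions; the unforced case is the accepted
`IsLerayHopfOn.ae_isLerayHopfOn_restart`. [cite: RobinsonRodrigoSadowski2016, Def. 4.9 and p. 131 (proof of Thm. 8.17)] -/
theorem IsLerayHopfOn.ae_isLerayHopfOn_restart_forced (hLH : IsLerayHopfOn T ν f u₀ u) (hν : 0 ≤ ν)
    (hfm : AEStronglyMeasurable (uncurry f) ((volume.restrict (Ioo 0 T)).prod (volume : Measure E)))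
    (hf2 : eLpNorm (uncurry f) 2 ((volume.restrict (Ioo 0 T)).prod (volume : Measure E)) < ⊤) :
    ∀ᵐ s ∂(volume.restrict (Ioo 0 T)),
      IsLerayHopfOn (T - s) ν (fun t => f (t + s)) (u s) (fun t => u (t + s)) := by
  obtain ⟨C, hC⟩ := hLH.energy_bound
  obtain ⟨G, hG, hGint, -, hae⟩ := hLH.weakGrad_energy
  filter_upwards [hae, ae_restrict_mem measurableSet_Ioo] with s hs hsI
  -- notation and elementary facts
  set g : ℝ → ℝ≥0∞ := fun τ => ∫⁻ x, ENNReal.ofReal (frobeniusNormSq (G τ x)) with hg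
  set W : ℝ → ℝ := fun τ => ∫ x, ⟪f τ x, u τ x⟫ with hW
  have hwork : ∀ a b : ℝ,
      ∫ τ in a..b, ∫ x, ⟪f (τ + s) x, u (τ + s) x⟫ = ∫ τ in a + s..b + s, W τ := by
    intro a b
    exact intervalIntegral.integral_comp_add_right (fun τ => W τ) s
  have hsub : Ioo (0 + s) (T - s + s) ⊆ Ioo 0 T := fun t ht =>
    ⟨by linarith [ht.1, hsI.1], by linarith [ht.2]⟩
  have hμ : volume.restrict (Ioo (0 + s) (T - s + s)) ≤ volume.restrict (Ioo 0 T) :=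
    Measure.restrict_mono hsub le_rfl
  -- strong right-continuity at `s`
  have h0 : Tendsto (fun t => eLpNorm (u t - u s) 2 volume) (𝓝[>] s) (𝓝 0) :=
    hLH.tendsto_eLpNorm_sub_nhdsGT_forced hν hfm hf2 hsI hs
  -- the shift `t ↦ t + s` at the filter `𝓝[>] 0 → 𝓝 s`
  have hsh : Tendsto (fun t : ℝ => t + s) (𝓝[>] (0 : ℝ)) (𝓝 s) :=
    (tendsto_add_right_nhdsGT_zero_real s).mono_right nhdsWithin_le_nhds
  refine
    { weak := hLH.isWeakNSSolutionOn_translate_forced hfm hf2 hsI h0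
      energy_bound := ⟨C, ae_restrict_Ioo_comp_add_right s (ae_mono hμ hC)⟩
      memLp := fun t ht => hLH.memLp (t + s) ⟨by linarith [ht.1, hsI.1], by linarith [ht.2]⟩
      weakGrad_energy := ⟨fun t => G (t + s), ae_restrict_Ioo_comp_add_right s (ae_mono hμ hG),
        ?_, ?_, ?_⟩
      weak_continuous := fun w hw => ?_
      strong_initial := h0.comp (tendsto_add_right_nhdsGT_zero_real s) }
  · -- `∇u(· + s) ∈ L²_{t,x}`
    have h1 := setLIntegral_Ioo_comp_add_right g 0 (T - s) s
    calc ∫⁻ t in Ioo 0 (T - s), ∫⁻ x, ENNReal.ofReal (frobeniusNormSq (G (t + s) x))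
        = ∫⁻ t in Ioo (0 + s) (T - s + s), g t := h1
      _ ≤ ∫⁻ t in Ioo 0 T, g t := lintegral_mono_set hsub
      _ < ∞ := hGint
  · -- energy inequality from `0` (= from `s` for `u`)
    intro t ht
    have h1 := hs (t + s) ⟨by linarith [ht.1], by linarith [ht.2]⟩
    rw [setLIntegral_Ioo_comp_add_right g 0 t s, zero_add]
    have h2 : ∫ τ in (0:ℝ)..t, ∫ x, ⟪(fun t => f (t + s)) τ x, (fun t => u (t + s)) τ x⟫ =
        ∫ τ in s..t + s, W τ := by
      have := hwork 0 t
      rw [zero_add] at this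
      exact this
    rw [h2]
    exact h1
  · -- energy inequality from a.e. `s'`
    have h1 := ae_restrict_Ioo_comp_add_right s (ae_mono hμ hae)
    filter_upwards [h1] with s' hs' t ht
    rw [setLIntegral_Ioo_comp_add_right g s' t s]
    have h2 : ∫ τ in s'..t, ∫ x, ⟪(fun t => f (t + s)) τ x, (fun t => u (t + s)) τ x⟫ =
        ∫ τ in s' + s..t + s, W τ := hwork s' t
    rw [h2]
    exact hs' (t + s) ⟨by linarith [ht.1], by linarith [ht.2]⟩
  · -- weak `L²` continuity on `(0, T - s]` and the weak limit at `0⁺`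
    obtain ⟨hco, -⟩ := hLH.weak_continuous w hw
    refine ⟨hco.comp (continuousOn_id.add continuousOn_const) fun t ht =>
      ⟨by linarith [ht.1, hsI.1], by linarith [ht.2]⟩, ?_⟩
    exact (hco.continuousAt (Ioc_mem_nhds hsI.1 hsI.2)).tendsto.comp hsh

/-- **Some good restarting time in every interval (forced).** Under the hypotheses of
`ae_isLerayHopfOn_restart_forced`, for all `0 ≤ a < b ≤ T` there is `s ∈ (a, b)` such that
`u(· + s)` is a Leray–Hopf weak solution on `[0, T - s)` with force `f(· + s)` from `u(s)`
(Robinson–Rodrigo–Sadowski 2016, Ch. 8, p. 121, proof of Lemma 8.4: "Take any `t' ∈ (t₀ - δ, t₀)`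
such that … the energy inequality holds for `t'`"). [cite: RobinsonRodrigoSadowski2016, Ch. 8 p. 121 (proof of Lemma 8.4)] -/
theorem IsLerayHopfOn.exists_isLerayHopfOn_restart_forced_Ioo (hLH : IsLerayHopfOn T ν f u₀ u)
    (hν : 0 ≤ ν)
    (hfm : AEStronglyMeasurable (uncurry f) ((volume.restrict (Ioo 0 T)).prod (volume : Measure E)))
    (hf2 : eLpNorm (uncurry f) 2 ((volume.restrict (Ioo 0 T)).prod (volume : Measure E)) < ⊤)
    {a b : ℝ} (ha : 0 ≤ a) (hab : a < b) (hbT : b ≤ T) :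
    ∃ s ∈ Ioo a b, IsLerayHopfOn (T - s) ν (fun t => f (t + s)) (u s) (fun t => u (t + s)) :=
  exists_mem_Ioo_of_ae_restrict_Ioo ha hab hbT (hLH.ae_isLerayHopfOn_restart_forced hν hfm hf2)

/-- **The translated force stays in the guarded class**: for `0 ≤ s`, `f(· + s)` is jointly
a.e.-strongly measurable on `(0, T - s) × E` with `‖f(· + s)‖_{L²((0,T-s) × E)} < ∞` — so the
forced Serrin–Masuda uniqueness theorem and this file apply again to the restarted solution
(Sohr 2001, Ch. V, Thm. 1.8.1, proof: the reduction "Since `T` can be replaced by `T'`" and the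
iteration after (1.8.20) restart the forced weak solution inside the same force class).
[cite: Sohr2001, Ch. V Thm. 1.8.1 (proof, reduction step)] -/
theorem force_translate_mem_guardedClass {s : ℝ} (hs : 0 ≤ s)
    (hfm : AEStronglyMeasurable (uncurry f) ((volume.restrict (Ioo 0 T)).prod (volume : Measure E)))
    (hf2 : eLpNorm (uncurry f) 2 ((volume.restrict (Ioo 0 T)).prod (volume : Measure E)) < ⊤) :
    AEStronglyMeasurable (uncurry fun t => f (t + s))
        ((volume.restrict (Ioo 0 (T - s))).prod (volume : Measure E)) ∧
      eLpNorm (uncurry fun t => f (t + s)) 2 ((volume.restrict (Ioo 0 (T - s))).prod (volume : Measure E))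
        < ⊤ :=
  ⟨aestronglyMeasurable_uncurry_translate_prod hs hfm, (eLpNorm_uncurry_translate_le hs 2).trans_lt hf2⟩

end Restart

end Literature.Analysis.FluidPDE

end
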